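import Summits.QuantumFields.BalabanUV.T4Continuum.Spine.NE7.Targets
import Summits.QuantumFields.BalabanUV.T4Continuum.Support.HistoryRealiseCellsRunApex

/-!
# Spine/NE7/CoreOfCountRoad — the NE7-proper leaf `Core` AT THE CARRIERS OF THE ROAD OF RECORD: `Core` ≡ the owner's
# `GoodClause`; `Core` ⇐ `ReindexedBudget`; and `Core ∧ Summable δ` read off ANY count-road witness
# (`HistoryRealiseCellsRunApex.CountRoadWitness`, the one displayed hypothesis of the apex road of record) — sorry-free, BY NAME

Cell `pub-balaban-gaps` (YM blitz Y1, track G2, seat `ne7`, generation 9; text of record `run/shared/lean/pub/pub-balaban-gaps/ne/NE7.md`).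
Companion of `Spine/NE7/Targets` (p339119).  Bookkeeping only: every theorem is a landed tree theorem BY NAME or `Iff.rfl`; no `def`;
nothing printed is used as a hypothesis; 0 sorry; axioms standard.

WHY THIS FILE.  The YM-DAG of the `pub-ymgap` plan types spine estimate NE7 as node N19 := `Spine.NE7.Core l₀ vol T Bad P Q δ` over the
shape's OWN abstract carriers, with a `sorry` slot `N19_holds` to be discharged «at the carriers of record» once (i) Bałaban's datum and
(ii) the ROAD OF RECORD carrying the nine spine estimates into binder B5 are fixed; the plan's default road (its Q8 (a)) is the COUNT
road's apex `HistoryRealiseCellsRunApex.hybridNE7Under_of_countRoad` (Support, row NE7b owner lineage), whose ONE displayed hypothesis per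
tuned run `g₀` and loop string `os` is a `CountRoadWitness D C O rr d n g₀ os ι α π` — the END of record's term data with H3, the E1∕E2
representation identities, the (γ) floors, NE7c's `ShellWeightBound`, and NE7's OWN content as the field
`budget : T4MatchingClosure.ReindexedBudget …` plus four summable rates `r u s s₂`.  This file records, in kernel and by name, what N19
becomes at those carriers:
* §1 `core_iff_goodClause` — `Spine.NE7.Core l₀ vol T Bad P Q δ` IS the owner's crux declaration `T4GoodClassBudget.GoodClause l₀ vol T P Q Bad δ`
  (route 1 of the b2b NE7 desk: `CruxDecl = GoodClause ∧ Summable δ`), definitionally — so route 1's docked END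
  (`NE7Route1EndDocked.goodClause_summable_of_route1_docked`, p317648) concludes `Core ∧ Summable δ` verbatim;
* §2 `core_of_reindexedBudget` — the per-term budget of node U5 (`ReindexedBudget`, interface I-2′: per good term a two-run sandwich whose
  constant splits as `CcRec + ν K` up to `vol·s₂ K` and whose radius is `≤ RrRec + vol·u K ≤ vol·(r K + u K)`, with a `t`-FREE class
  constant `c₀ K`) gives `Core` with the constant `c₀ K + ν K` and the remainder `δ K = (r K + u K) + (s K + s₂ K)`
  (`T4MatchingClosure.goodClause_of_reindexed` BY NAME), summable from the four named pieces (`summable_reindexedDelta`);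
* §3 `core_of_countRoadWitness` ∕ `summable_coreDelta_of_countRoadWitness` ∕ `target_leaf_of_countRoadWitness` — for EVERY count-road
  witness `X`, node N19's statement holds AT THE WITNESS'S CARRIERS: source radius `X.l₀`, volume factor `X.vol`, term families `X.T`,
  bad classes = the END's `badOfClass … (badClasses …)` family read through H3's pedigree map, cores `X.A − X.shA` (run A, `K` steps) and
  `X.A' − X.shB` (run B, `K + 1` steps), remainder `(X.r + X.u) + (X.s + X.s₂)` — and that remainder is summable.  This is the sorry-free
  form of the slot `N19_holds` under the plan's default road: the uninterpreted `CarriersOfRecordN19 l₀ vol T Bad P Q δ` is to be read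
  «`(l₀, vol, T, Bad, P, Q, δ)` are the carriers of a `CountRoadWitness` of Bałaban's datum», and then N19 follows from the witness's
  `budget` field ALONE (none of H3, the representation identities, the floors or NE7c is used for N19 — they serve N20∕N21 and the
  dictionary);
* §4 `target_of_stringHybridNE7` — node U5's TARGET `Spine.NE7.Target vol l₀ δ′ (schemeZ S os)` (= `MatchingModConstants ∧ Summable`)
  for the string's Wilson-normalised dressed partition functions from a per-string hybrid datum, positivity and the free head
  discharged — `T4MatchingAssembly.matchingModConstants_schemeZ` BY NAME, in the `Target` spelling the YM-DAG records as N19's consumer.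

HONEST FRAMING.  NOTHING is discharged: a `CountRoadWitness` on Bałaban's datum is a HYPOTHESIS (none exists in the tree; the cell's
datum of record is «none yet»), and its `budget` field IS spine estimate NE7 (with NE1′–NE5, NE9 inside its producers) as a hypothesis
shape — NOT IN PRINT ([Balaban1989LargeFieldII] p. 356 defers even one-run loop observables; template [King1986] (3.10)–(3.13)), NOT
PROVED.  What the file settles is only WHICH statement N19 is at the road-of-record carriers and that it is the `budget` field read
through two landed bookkeeping theorems.  One fixed finite T⁴, rung (B)+1 — NOT ℝ⁴, NOT infinite volume, NOT a mass gap, NOT Clay.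
HONEST DEPENDENCY: continuum YM on T⁴ ⇐ (B) ∧ β-input ∧ nine spine estimates (0∕9 proved); this file changes no census value.
-/

noncomputable section

open Finset MeasureTheory

namespace Summit.QuantumFields.BalabanUV.T4Continuum.Spine.NE7

open Literature.MathematicalPhysics.QuantumFieldTheory.Balaban1983to89
open Literature.MathematicalPhysics.QuantumFieldTheory.Balaban1983to89.T4CauchySum
open Literature.MathematicalPhysics.QuantumFieldTheory.Balaban1983to89.T4GoodClassBudget
open Literature.MathematicalPhysics.QuantumFieldTheory.Balaban1983to89.T4MatchingClosure
open Literature.MathematicalPhysics.QuantumFieldTheory.Balaban1983to89.T4MatchingAssembly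
open Literature.MathematicalPhysics.QuantumFieldTheory.Balaban1983to89.T4Continuum

/-! ## §1 `Core` is the owner's `GoodClause` -/

section CoreGoodClause

variable {ι : Type*} [DecidableEq ι] {l₀ vol : ℝ} {T : ℕ → Finset ι} {Bad : ℕ → ℝ → Finset ι} {P Q : ℕ → ℝ → ι → ℝ}
  {δ : ℕ → ℝ}

/-- [bookkeeping] `Spine.NE7.Core l₀ vol T Bad P Q δ` and the b2b NE7 desk's crux declaration
`T4GoodClassBudget.GoodClause l₀ vol T P Q Bad δ` are the SAME proposition (only the argument order differs). [folklore] -/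
theorem core_iff_goodClause : Core l₀ vol T Bad P Q δ ↔ GoodClause l₀ vol T P Q Bad δ := Iff.rfl

/-- [bookkeeping] `GoodClause ⟹ Core`. [folklore] -/
theorem core_of_goodClause (h : GoodClause l₀ vol T P Q Bad δ) : Core l₀ vol T Bad P Q δ := h

/-- [bookkeeping] `Core ⟹ GoodClause`. [folklore] -/
theorem goodClause_of_core (h : Core l₀ vol T Bad P Q δ) : GoodClause l₀ vol T P Q Bad δ := h

end CoreGoodClause

/-! ## §2 `Core` from node U5's per-term budget `ReindexedBudget` -/

section Reindexed

variable {ι : Type*} [DecidableEq ι] {l₀ vol : ℝ} {T : ℕ → Finset ι} {A B : ℕ → ℝ → ι → ℝ} {Bad : ℕ → ℝ → Finset ι}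
  {Cc Rr CcRec RrRec : ℕ → ℝ → ι → ℝ} {ν u s₂ c₀ r s : ℕ → ℝ}

/-- [bookkeeping] **`ReindexedBudget ⟹ Core`** with the remainder `δ K = (r K + u K) + (s K + s₂ K)` (and the constant `c₀ K + ν K`):
`T4MatchingClosure.goodClause_of_reindexed` BY NAME, read in the `Core` spelling. [folklore] -/
theorem core_of_reindexedBudget (h : ReindexedBudget l₀ vol T A B Bad Cc Rr CcRec RrRec ν u s₂ c₀ r s) :
    Core l₀ vol T Bad A B fun K => (r K + u K) + (s K + s₂ K) :=
  goodClause_of_reindexed h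

/-- [bookkeeping] … and its remainder is summable from the four named summable rates (`summable_reindexedDelta` BY NAME), so the pair
`Core ∧ Summable δ` — node N19 plus the `summable` leaf of `HybridNE7` — is read off the budget and the rates. [folklore] -/
theorem core_and_summable_of_reindexedBudget (h : ReindexedBudget l₀ vol T A B Bad Cc Rr CcRec RrRec ν u s₂ c₀ r s)
    (hr : Summable r) (hu : Summable u) (hs : Summable s) (hs₂ : Summable s₂) :
    Core l₀ vol T Bad A B (fun K => (r K + u K) + (s K + s₂ K)) ∧ Summable fun K => (r K + u K) + (s K + s₂ K) :=
  ⟨core_of_reindexedBudget h, summable_reindexedDelta hr hu hs hs₂⟩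

end Reindexed

/-! ## §3 Node N19 at the carriers of a count-road witness -/

section CountRoad

open Literature.MathematicalPhysics.QuantumFieldTheory.Balaban1983to89.B13ScaleTransfer
open T4PersistenceDictionary T4PersistentHistoryCount T4BankedInduction T4PrintedShapeBanking
open T4WeightBudget T4GlobalDenominator T4LiveClassFibration T4LiveStructureGas T4LiveGasToTerms T4RecordPriceSeam
open T4PartnerMultiplicity T4IndicatorShell T4MatchingClosureSocket
open T4StabilitySocket T4BranchingRecordsGas T4TaggedShapeBanking T4CanonicalMenus T4RenewalChains
open Summit.QuantumFields.BalabanUV.T4Continuum.PlacementBatch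
open Summit.QuantumFields.BalabanUV.T4Continuum.PlacementSkeleton
open Summit.QuantumFields.BalabanUV.T4Continuum.CountThresholdUniform
open Summit.QuantumFields.BalabanUV.T4Continuum.CountThresholdExit
open Summit.QuantumFields.BalabanUV.T4Continuum.CountSeamJunction
open Summit.QuantumFields.BalabanUV.T4Continuum.LateMergers
open Summit.QuantumFields.BalabanUV.T4Continuum.HistoryFlow
open Summit.QuantumFields.BalabanUV.T4Continuum.HistoryRegeneration
open Summit.QuantumFields.BalabanUV.T4Continuum.HistoryTables
open Summit.QuantumFields.BalabanUV.T4Continuum.HistoryAssemblyTrees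
open Summit.QuantumFields.BalabanUV.T4Continuum.HistoryAssemblyTerms
open Summit.QuantumFields.BalabanUV.T4Continuum.HistoryAssemblyPedigree
open Summit.QuantumFields.BalabanUV.T4Continuum.HistoryConstants
open Summit.QuantumFields.BalabanUV.T4Continuum.HistoryGen
open Summit.QuantumFields.BalabanUV.T4Continuum.ZoneSkeleton
open Summit.QuantumFields.BalabanUV.T4Continuum.HistorySocketTH
open Summit.QuantumFields.BalabanUV.T4Continuum.HistoryCaps
open Summit.QuantumFields.BalabanUV.T4Continuum.HistoryAssemblyPrice
open Summit.QuantumFields.BalabanUV.T4Continuum.HistoryBankingLE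
open Summit.QuantumFields.BalabanUV.T4Continuum.HistoryTreeShapeLE
open Summit.QuantumFields.BalabanUV.T4Continuum.HistoryExitLE
open Summit.QuantumFields.BalabanUV.T4Continuum.HistoryAssemblyTermsLE
open Summit.QuantumFields.BalabanUV.T4Continuum.HistoryRealise
open Summit.QuantumFields.BalabanUV.T4Continuum.HistoryAssemblyRealiseLE
open Summit.QuantumFields.BalabanUV.T4Continuum.HistoryAssemblyRealisePrice
open Summit.QuantumFields.BalabanUV.T4Continuum.HistoryZones
open Summit.QuantumFields.BalabanUV.T4Continuum.HistoryAssemblyRealiseRun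
open Summit.QuantumFields.BalabanUV.T4Continuum.HistoryAssemblyRealiseRunEnd
open Summit.QuantumFields.BalabanUV.T4Continuum.HistoryRealiseCells
open Summit.QuantumFields.BalabanUV.T4Continuum.HistoryRealiseCellsRun
open Summit.QuantumFields.BalabanUV.T4Continuum.HistoryRealiseCellsRunEnd
open Summit.QuantumFields.BalabanUV.T4Continuum.HistoryRealiseCellsRunPinned
open Summit.QuantumFields.BalabanUV.T4Continuum.HistoryHybridRescale
open Summit.QuantumFields.BalabanUV.T4Continuum.HistoryRealiseCellsRunApex

variable {F : T4Family} {G : Type*} [GaugeGroup G] [MeasurableSpace G] [HaarData G]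
  {D : FiniteEpsData F G} {C : T4PrintedShapeBanking.Consts} {O : PrintedO1s} {rr d n : ℕ} {g₀ : ℕ → ℝ}
  {os : List (ULoop F)} {ι α π : Type} [DecidableEq ι] [DecidableEq α] [DecidableEq π]

/-- [bookkeeping] **NODE N19 AT THE CARRIERS OF A COUNT-ROAD WITNESS.**  For every `X : CountRoadWitness D C O rr d n g₀ os ι α π` the
NE7-proper leaf holds for the witness's own carriers — source radius `X.l₀`, volume factor `X.vol`, term families `X.T`, the END's bad
classes read through H3's pedigree map, the shell-free cores `X.A − X.shA` (run A) and `X.A' − X.shB` (run B), remainder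
`(X.r + X.u) + (X.s + X.s₂)` — from the field `X.budget` ALONE (`core_of_reindexedBudget`).  The witness is the hypothesis; nothing of
Bałaban's is asserted. [folklore] -/
theorem core_of_countRoadWitness (X : CountRoadWitness D C O rr d n g₀ os ι α π) :
    Core X.l₀ X.vol X.T
      (badOfClass (bstrOf Prod.fst (memOf X.ped X.liveC (cellOfR n F.L (runProfile F.L X.R) X.ped X.cellP))) X.T
        fun K _ => badClasses Prod.fst (memOf X.ped X.liveC (cellOfR n F.L (runProfile F.L X.R) X.ped X.cellP)) jhalf X.T K)
      (fun K t τ => X.A K t τ - X.shA K t τ) (fun K t τ => X.A' K t τ - X.shB K t τ)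
      fun K => (X.r K + X.u K) + (X.s K + X.s₂ K) :=
  core_of_reindexedBudget X.budget

/-- [bookkeeping] … and the remainder of N19 at those carriers is summable, from the witness's four summable rates. [folklore] -/
theorem summable_coreDelta_of_countRoadWitness (X : CountRoadWitness D C O rr d n g₀ os ι α π) :
    Summable fun K => (X.r K + X.u K) + (X.s K + X.s₂ K) :=
  summable_reindexedDelta X.sum_r X.sum_u X.sum_s X.sum_s₂

/-- [bookkeeping] **N19 ∧ `Summable δ` at the witness's carriers, in one statement** — the sorry-free form of the YM-DAG slot `N19_holds`
under the plan's default road (the uninterpreted `CarriersOfRecordN19` read as «the carriers of a count-road witness of the datum»).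
CONDITIONAL on the witness; nothing discharged. [folklore] -/
theorem target_leaf_of_countRoadWitness (X : CountRoadWitness D C O rr d n g₀ os ι α π) :
    Core X.l₀ X.vol X.T
        (badOfClass (bstrOf Prod.fst (memOf X.ped X.liveC (cellOfR n F.L (runProfile F.L X.R) X.ped X.cellP))) X.T
          fun K _ => badClasses Prod.fst (memOf X.ped X.liveC (cellOfR n F.L (runProfile F.L X.R) X.ped X.cellP)) jhalf X.T K)
        (fun K t τ => X.A K t τ - X.shA K t τ) (fun K t τ => X.A' K t τ - X.shB K t τ)
        (fun K => (X.r K + X.u K) + (X.s K + X.s₂ K)) ∧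
      Summable fun K => (X.r K + X.u K) + (X.s K + X.s₂ K) :=
  ⟨core_of_countRoadWitness X, summable_coreDelta_of_countRoadWitness X⟩

/-- [bookkeeping] The witness's source radius and volume factor are positive (the side conditions the apex feeds to
`matchingModConstants_schemeZ`), recorded next to N19 for the re-typing event. [folklore] -/
theorem carriers_pos_of_countRoadWitness (X : CountRoadWitness D C O rr d n g₀ os ι α π) : 0 < X.l₀ ∧ 0 < X.vol :=
  ⟨X.l₀_pos, X.vol_pos⟩

end CountRoad

/-! ## §4 Node U5's TARGET for a string's dressed partition functions from a per-string hybrid datum -/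

section TargetOfString

open Missing

variable {G : Type*} [GaugeGroup G] [MeasurableSpace G] [RegularGaugeGroup G] [HaarData G] {O : Type*}

/-- [bookkeeping] **PER STRING: a `StringHybridNE7` datum from `K₀` on ⟹ node U5's TARGET** `Spine.NE7.Target vol l₀ δ′ (schemeZ S os)`
(`= MatchingModConstants vol l₀ δ′ (schemeZ S os) ∧ Summable δ′`) for the string's Wilson-normalised dressed partition functions over the
WHOLE sequence of cutoffs, for a scheme with `β_K ≥ 0` and measurable observables bounded by `1` (positivity by `dressedZ_pos`, the head
`K < K₀` free) — `T4MatchingAssembly.matchingModConstants_schemeZ` BY NAME, in the spelling the YM-DAG records as N19's consumer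
(`N19target := Spine.NE7.Target`). [folklore] -/
theorem target_of_stringHybridNE7 (S : TorusScheme G O) (hβ : ∀ K, 0 ≤ S.β K) (hm : ∀ K o, Measurable (S.obs K o))
    (h1 : ∀ K o U, |S.obs K o U| ≤ 1) {l₀ vol : ℝ} (hl₀ : 0 ≤ l₀) (hvol : 0 < vol) (os : List O) {K₀ : ℕ}
    (h : StringHybridNE7 S os l₀ vol K₀) :
    ∃ δ' : ℕ → ℝ, Target vol l₀ δ' (T4GenFunBounds.schemeZ S os) := by
  obtain ⟨δ', hδ', hM⟩ := matchingModConstants_schemeZ S hβ hm h1 hl₀ hvol os h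
  exact ⟨δ', hM, hδ'⟩

end TargetOfString

end Summit.QuantumFields.BalabanUV.T4Continuum.Spine.NE7

end
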